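import Literature.MathematicalPhysics.QuantumFieldTheory.Balaban1983to89.B9PerturbationMajorantLetters

/-!
# `Balaban1983to89.B9PerturbationMajorant2Letters` — [B9] (3.135)∕(3.137) pp. 422–423 AS BLOCK-MAJORANT ALGEBRA, THE TWO-SIDED SPLIT: the raw residual
# Δ⁽²⁾ ((3.137)) and the three SANDWICHED letters X = −RG′D\*Δ⁽²⁾, Y = −Δ⁽²⁾DG′R, Z = RG′D\*Δ⁽²⁾DG′R of
# Δ⁽²⁾_π = Δ⁽²⁾ + D_U∘X + Y∘D\*_U + D_U∘Z∘D\*_U between the state classes, from the schemas `Thm31GpMaj`, `Proj349Maj` and ONE (3.137)-shaped majorant of Δ⁽²⁾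

T. Bałaban, *Propagators for lattice gauge theories in a background field*, Commun. Math. Phys. **99** (1985) 389–434 [`Balaban1985BackgroundPropagators`,
"B9"]; [4] = T. Bałaban, *Propagators and renormalization transformations for lattice gauge theories. II*, Commun. Math. Phys. **96** (1984) 223–250
[`Balaban1984PropagatorsII`].  statement-level skeleton of published theorems with citation tags; proofs where landed; nothing here is a claim about
the Yang–Mills mass gap.  Sequel of `B9PerturbationMajorantAlgebra` ∕ `B9PerturbationMajorantLetters` (the 𝔠^{(s)} calculus, the schemas, the six
propagator letters 𝒫 … 𝒮†); PDF held (`paper:balaban1985-cmp99-background-propagators`), pp. 397–399, 421–423 re-read first-hand this generation.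

THE PRINT.  p. 422, (3.135): *"Δ⁽²⁾_π = Δ⁽²⁾ − DRG′D\*Δ⁽²⁾ − Δ⁽²⁾DG′RD\* + DRG′D\*Δ⁽²⁾DG′RD\*"*; p. 423, (3.137): *"|(Δ⁽²⁾A)(b)| ≦ O(1)Mα₀(Lʲη)⁻²|A|, b ∈ Δ(y),
y ∈ Λ_j and the supremum |A| is taken over several j-blocks surrounding Δ(y)"*; p. 423: *"we have derivatives in the operator Δ′_π + Δ⁽²⁾_π which have to be
applied either to the operator on the right, or on the left, because kernels of the operators defining Δ′_π + Δ⁽²⁾_π are not regular enough"*; Thm 3.1 (3.42)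
p. 397 (the FOUR sup entries G′, ∇_UG′, G′∇\*_U, Δ_UG′ — no ∇G′∇\*), (3.44) p. 398 (∇_UG′∇\*_U only from a HÖLDER input, B₀′(ε) → ∞ as ε → 0), (3.49) p. 399.

THE POINT (dag-n06-l LOCATED-U8, cell bus l.45635, HOME `DELTA2-LETTERS-MEMO.md`).  The ONE-SIDED splits of Δ⁽²⁾_π used so far (`Letters3131.split₂`:
Δ⁽²⁾_π = T_a₂ + D_U∘T_b₂ with T_a₂ = Δ⁽²⁾π, π = 1 − D_UG′RD\*_U; `Letters3131R.splitR₂`) leave the order-zero sandwich D_UG′(R)D\*_U inside the letter that is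
then asked to act on a RAW sup class — a word print never bounds that way.  The TWO-SIDED split
  Δ⁽²⁾_π = M + D_U∘X + Y∘D\*_U + D_U∘Z∘D\*_U,  M = Δ⁽²⁾,  X = −𝒮M,  Y = −M𝒮†,  Z = 𝒮M𝒮†,  𝒮 = RG′D\*_U,  𝒮† = D_UG′R,
has FOUR inner letters each of which IS a printed species: every derivative sits next to exactly one G′ ((3.42)₂,₃, across R = ϱ(I − P) by (3.49)₁), the
leading D_U is left for the LEFT neighbour (G₀D_U) and the trailing D\*_U for the RIGHT neighbour (D\*_UG₀, D\*_UG₀D_U) — p. 423's instruction.  THIS FILE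
majorises the four letters between the state classes of `B9Thm312WholeClasses` (`cNormR … s`: size near y = (Lʲη)ˢ·sup_{Δ(y)}|·|; `cNorm … q` = `cNormR … (−q)`)
from `Thm31GpMaj` (entries `e0 e1 e2`), `Proj349Maj` (`p0 p1 p2`) and ONE [4]-(2.51)-shaped majorant of the raw residual,
`hD2 : HasMajorant blk D2 (θ₂·(len a)⁻²·e^{−δ₂d})` — (3.137) verbatim, the shape of the N06 certificate's display `hD2sup` about def-Y's free letter `Δ2`:
* §1 `d2_cls` (Δ⁽²⁾ : 𝔠⁽⁰⁾ → 𝔠^{(2)}_R, i.e. size (Lʲη)⁻²), `maj_M` (Δ⁽²⁾ : `cNorm … 2 → cNorm … 0`, constant θ₂L²), `maj_M_R` (the same at real weights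
  `cNormR … (−2) → cNormR … 0` — the Y-word input of the Hölder engine of `B9SmoothHolderClassPProducers`);
* §2 ★ `maj_X2` (X-word `R∘G′∘D\*∘Δ⁽²⁾ : cNorm … blk 2 → cNorm … blkW 1`), ★ `maj_Y2` (Y-word `Δ⁽²⁾∘D∘G′∘R : cNorm … blkW 1 → cNorm … blk 0`) and `maj_Y2_R` (its
  real-weight form `cNormR … blkW (−1) → cNormR … blk 0`), ★ `maj_Z2` (Z-word `R∘G′∘D\*∘Δ⁽²⁾∘D∘G′∘R : cNorm … blkW 1 → cNorm … blkW 1`); each for the word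
  with a scalar weight `w` (as the words occur at node00-def-Y's pinned models), majorant `|w|·K·e^{−δ_T d}` with `K` an explicit product of θ₂,
  `constA ϱ B₀ C_P c L`, `c`, powers of `L`, for every δ_T ≧ 0 with δ_T + 2σ + 3αδ ≦ r ≦ min(δ₀, δ_P, δ₂) (at most two compositions and three transfers).
* §3 ★★★ `maj_ta2_of_src` — the ONE-SIDED letter T_a₂ = Δ⁽²⁾∘(1 − D_UG′RD\*_U) of the left split IS a printed species from a REGULAR source class `b₁`: one
  carrying the (3.44) member of the sandwich D_UG′D\*_U (print's Hölder input; at G₀-outputs Theorem 3.3) and a sup reading, both at dimension 2 — the honest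
  form of the certificate's `hta₂` (source = the state class of the step instead of the raw 𝔠⁽²⁾); `hasMaj_tgt_ofR`; ★★ `maj_tb2_of_src` (T_b₂ = −𝒮T_a₂, sup target).
The readings at the pinned models (the split of def-Y's `T2coK` into the four words, the sup letters from the certificate's `hD2sup h31 h49`, the X∕Z words and
T_b₂ INTO the (P2′) Hölder class from ONE (3.43) member) are the sequel `B9Thm313WholeDelta2LettersAtPinsPrint`.
HONEST SCOPE.  Kernel-checked bookkeeping over FREE finite carriers with block maps; Theorem 3.1, (3.49), (3.137) enter as HYPOTHESIS SCHEMAS (nothing of [B9]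
or [4] asserted; at Δ⁽²⁾ = 0 every letter here is the zero map); the constants are ours, explicit, not optimised; count-neutral; N06 NOT discharged; one
finite lattice at a time — nothing continuum ∕ ℝ⁴ ∕ OS ∕ mass gap ∕ Clay.  Cell `pub-ymgap` (HUMAN RULING D-0062), Track A node N06 [B9], bundle F7 rows
20–21, seat `pub-ymgap-dag-n06-l` (g26), 2026-08-29.  NEW file; nothing landed is modified.
-/

namespace Literature.MathematicalPhysics.QuantumFieldTheory.Balaban1983to89.B9PerturbationMajorant2Letters

open Literature.MathematicalPhysics.QuantumFieldTheory.Balaban1983to89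
open Finset B6RandomWalk B6RandomWalkHom B9Thm34Ext B11SectG B9SectDSup B9Thm312Whole B9Thm312WholeClasses
open B9Thm37AllNorms B9RWSums343to347Whole B9RWSums346Schur B9Ineq347 B9PerturbationMajorantAlgebra B9PerturbationMajorantLetters

noncomputable section

variable {g : B9.Geometry} {XS XB : Type} [Fintype XS] [Fintype XB] [Fintype g.Site]
variable {R₀ : ℝ} {H₀ : Prop}

/-! ## §1 The raw residual Δ⁽²⁾ between the state classes, from its (3.137)-shaped block majorant -/

section Residual

variable {blk : XB → g.Site} {D2 : Module.End ℝ (XB → ℝ)} {θ₂ δ₂ r δT : ℝ} {dF : ℕ} {δ α L₀ : ℝ}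

omit [Fintype XS] in
/-- **(3.137) AS A MAP OF STATE CLASSES**: the block majorant |(Δ⁽²⁾A)(b)| ≦ θ₂(Lʲη)⁻²e^{−δ₂d(y,y′)}|A| (b ∈ Δ(y), supp A ⊂ Δ(y′)) is the majorant θ₂·e^{−rd} of Δ⁽²⁾ from
𝔠⁽⁰⁾ into 𝔠_R^{(2)} (size (Lʲη)²·sup), any rate r ≦ δ₂. [cite: Balaban1985BackgroundPropagators, (3.137) p.423; Balaban1984PropagatorsII, (2.51) p.232] -/
theorem d2_cls (hG : GeoOK g) (hθ₂ : 0 ≤ θ₂) (hr : r ≤ δ₂)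
    (hD2 : HasMajorant (g := toB6 g R₀ H₀) blk D2 (fun (a b : g.Site) => θ₂ * (g.len a ^ 2)⁻¹ * Real.exp (-(δ₂ * g.dist a b)))) :
    HasMaj (cNormR R₀ H₀ blk hG.lenle 0) (cNormR R₀ H₀ blk hG.lenle 2) D2 (fun a b => θ₂ * Real.exp (-(r * g.dist a b))) := by
  have h0 : HasMajorantHom (g := toB6 g R₀ H₀) blk blk D2
      (fun (a b : g.Site) => θ₂ * g.len a ^ (-2 : ℝ) * Real.exp (-(δ₂ * g.dist a b))) := by
    refine hasMajorantHom_mono (g := toB6 g R₀ H₀) blk blk ((hasMajorantHom_iff (g := toB6 g R₀ H₀) blk D2 _).mpr hD2) fun a b => le_of_eq ?_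
    show θ₂ * (g.len a ^ 2)⁻¹ * Real.exp (-(δ₂ * g.dist a b)) = θ₂ * g.len a ^ (-2 : ℝ) * Real.exp (-(δ₂ * g.dist a b))
    rw [Real.rpow_neg (hG.lenle a), Real.rpow_ofNat]
  have h1 := hasMaj_cls_of_hom hG (-2) hθ₂ h0
  rw [neg_neg] at h1
  exact hasMaj_weaken hG hθ₂ le_rfl hr h1

omit [Fintype XS] in
/-- **Δ⁽²⁾ AT REAL WEIGHTS `cNormR … (−2) → cNormR … 0`** (one transfer, p. 398: constant θ₂L², rate δ_T ≦ r − αδ): the Y-word input shape of the Hölder engine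
`B9SmoothHolderClassPProducers.hasMaj_R_GpDvs_comp_into_bHZPG`. [cite: Balaban1985BackgroundPropagators, (3.137) p.423 + p.398 (remark after (3.47)); Balaban1984PropagatorsII, Lemma 2.1 (2.60) p.234] -/
theorem maj_M_R (hG : GeoOK g) (hF : Facts347 g R₀ H₀ dF δ α L₀) (hθ₂ : 0 ≤ θ₂) (hr : r ≤ δ₂) (hδT : δT + α * δ ≤ r)
    (hD2 : HasMajorant (g := toB6 g R₀ H₀) blk D2 (fun (a b : g.Site) => θ₂ * (g.len a ^ 2)⁻¹ * Real.exp (-(δ₂ * g.dist a b)))) :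
    HasMaj (cNormR R₀ H₀ blk hG.lenle (-2)) (cNormR R₀ H₀ blk hG.lenle 0) D2 (fun a b => θ₂ * g.L ^ 2 * Real.exp (-(δT * g.dist a b))) := by
  have hL0 : 0 ≤ g.L := le_trans zero_le_one hF.one_le_L
  have h := hasMaj_shift hG hF (-2 : ℝ) (by norm_num) hθ₂ (d2_cls hG hθ₂ hr hD2)
  rw [rpow_abs_eq_pow g.L (-2) 2 (by norm_num), show (0 : ℝ) + -2 = -2 by norm_num, show (2 : ℝ) + -2 = 0 by norm_num] at h
  exact hasMaj_weaken hG (mul_nonneg hθ₂ (pow_nonneg hL0 2)) le_rfl (by linarith) h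

omit [Fintype XS] in
/-- ★ **THE LETTER M = Δ⁽²⁾ : 𝔠⁽²⁾ → 𝔠⁽⁰⁾** (the integer state norms of rows 20–21): majorant θ₂L²·e^{−δ_T d} for δ_T + αδ ≦ r ≦ δ₂.
[cite: Balaban1985BackgroundPropagators, (3.137) p.423 + p.398 (remark after (3.47)); Balaban1984PropagatorsII, Lemma 2.1 (2.60) p.234] -/
theorem maj_M (hG : GeoOK g) (hF : Facts347 g R₀ H₀ dF δ α L₀) (hθ₂ : 0 ≤ θ₂) (hr : r ≤ δ₂) (hδT : δT + α * δ ≤ r)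
    (hD2 : HasMajorant (g := toB6 g R₀ H₀) blk D2 (fun (a b : g.Site) => θ₂ * (g.len a ^ 2)⁻¹ * Real.exp (-(δ₂ * g.dist a b)))) :
    HasMaj (cNorm R₀ H₀ blk hG.lenle 2) (cNorm R₀ H₀ blk hG.lenle 0) D2 (fun a b => θ₂ * g.L ^ 2 * Real.exp (-(δT * g.dist a b))) := by
  have h := maj_M_R hG hF hθ₂ hr hδT hD2
  rw [show (-2 : ℝ) = -((2 : ℕ) : ℝ) by norm_num, show (0 : ℝ) = -((0 : ℕ) : ℝ) by norm_num] at h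
  exact hasMaj_ofR hG h

end Residual

/-! ## §2 The three sandwiched letters X = −𝒮Δ⁽²⁾, Y = −Δ⁽²⁾𝒮†, Z = 𝒮Δ⁽²⁾𝒮† of the two-sided split (signs carried by the weights `w`) -/

section Letters

variable {blkW : XS → g.Site} {blk : XB → g.Site} {Gp P R : Module.End ℝ (XS → ℝ)} {Dv : (XS → ℝ) →ₗ[ℝ] (XB → ℝ)}
  {Dvs : (XB → ℝ) →ₗ[ℝ] (XS → ℝ)} {D2 : Module.End ℝ (XB → ℝ)} {B₀ δ₀ CP δP θ₂ δ₂ r δT ϱ σ c : ℝ} {dF : ℕ} {δ α L₀ : ℝ}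

/-- ★ **THE X-WORD `RG′D\*_U∘Δ⁽²⁾ : 𝔠⁽²⁾ → 𝔠_W⁽¹⁾`** (under the leading D_U of (3.135)'s second term; 𝒮 = RG′D\*_U by (3.42)₃ + (3.49)₁, `maj_RGpDvs`, AFTER Δ⁽²⁾ by
(3.137)): for the word with a scalar weight `w`, majorant `|w|·(A·θ₂L²·c)·e^{−δ_T d}`, A = `constA ϱ B₀ C_P c L`, for 0 ≦ δ_T, δ_T + 2σ + 3αδ ≦ r ≦ min(δ₀, δ_P, δ₂)
(one composition, one transfer). [cite: Balaban1985BackgroundPropagators, (3.135) p.422, (3.137) p.423, p.423 («applied … on the left»), (3.42) p.397, (3.49) p.399; Balaban1984PropagatorsII, (2.54), (2.60)–(2.61) pp.233–234] -/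
theorem maj_X2 (hG : GeoOK g) (hF : Facts347 g R₀ H₀ dF δ α L₀) (hrow : RowSum (toB6 g R₀ H₀) σ c)
    (h31 : Thm31GpMaj blkW blk Gp Dv Dvs R₀ H₀ B₀ δ₀) (h49 : Proj349Maj blkW blk P Dv Dvs R₀ H₀ CP δP)
    (hD2 : HasMajorant (g := toB6 g R₀ H₀) blk D2 (fun (a b : g.Site) => θ₂ * (g.len a ^ 2)⁻¹ * Real.exp (-(δ₂ * g.dist a b))))
    (hR : R = ϱ • (LinearMap.id - P)) (hϱ : 0 ≤ ϱ) (hB₀ : 0 ≤ B₀) (hCP : 0 ≤ CP) (hθ₂ : 0 ≤ θ₂) (hc : 0 ≤ c) (hσ : 0 ≤ σ) (hτ : 0 ≤ α * δ)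
    (hr₀ : r ≤ δ₀) (hrP : r ≤ δP) (hr₂ : r ≤ δ₂) (hδT₀ : 0 ≤ δT) (hδT : δT + 2 * σ + 3 * (α * δ) ≤ r) (w : ℝ) :
    HasMaj (cNorm R₀ H₀ blk hG.lenle 2) (cNorm R₀ H₀ blkW hG.lenle 1) (w • (R ∘ₗ Gp ∘ₗ Dvs ∘ₗ D2))
      (fun a b => |w| * (constA ϱ B₀ CP c g.L * (θ₂ * g.L ^ 2) * c) * Real.exp (-(δT * g.dist a b))) := by
  have hL0 : 0 ≤ g.L := le_trans zero_le_one hF.one_le_L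
  have hA : 0 ≤ constA ϱ B₀ CP c g.L := constA_nonneg hϱ hB₀ hCP hc
  -- 𝒮 = RG′D* : 𝔠^{(0)} → 𝔠_W^{(−1)}, rate r − σ − αδ
  have hS := maj_RGpDvs hG hF hrow (h31.gpDvs_cls hG hB₀ hr₀) (h49.p_cls hG hCP hrP) hR hϱ hB₀ hCP hc hσ hτ (by linarith)
  -- Δ⁽²⁾ : 𝔠^{(−2)} → 𝔠^{(0)}, rate r − αδ
  have hM := maj_M_R hG hF hθ₂ hr₂ (show (r - α * δ) + α * δ ≤ r by linarith) hD2
  -- 𝒮 ∘ Δ⁽²⁾ : 𝔠^{(−2)} → 𝔠_W^{(−1)} at the rate δ_T (δ_T ≤ r − αδ, δ_T + σ ≤ r − σ − αδ)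
  have hc1 := hasMaj_comp_cNormR hG hrow hA (mul_nonneg hθ₂ (pow_nonneg hL0 2)) hδT₀ (by linarith) (by linarith) hS hM
  rw [show (-2 : ℝ) = -((2 : ℕ) : ℝ) by norm_num, show (-1 : ℝ) = -((1 : ℕ) : ℝ) by norm_num] at hc1
  refine (hasMaj_ofR hG (hasMaj_smul_exp hc1 w)).congr (T' := w • (R ∘ₗ Gp ∘ₗ Dvs ∘ₗ D2)) fun μ => ?_
  simp only [LinearMap.smul_apply, LinearMap.comp_apply]

/-- **THE Y-WORD AT REAL WEIGHTS `Δ⁽²⁾∘D_UG′R : cNormR … blkW (−1) → cNormR … blk 0`** (before the trailing D\*_U of (3.135)'s third term; 𝒮† = D_UG′R by (3.42)₂ +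
(3.49)₁, `maj_DvGpR`, shifted by −1, then Δ⁽²⁾ shifted by −2): majorant `|w|·(θ₂L²·A·L·c)·e^{−δ_T d}` — the Y-word input shape of the Hölder engine for the Z-word.
[cite: Balaban1985BackgroundPropagators, (3.135) p.422, (3.137) p.423, p.423 («applied either to the operator on the right»), (3.42) p.397, (3.49) p.399; Balaban1984PropagatorsII, (2.54), (2.60)–(2.61) pp.233–234] -/
theorem maj_Y2_R (hG : GeoOK g) (hF : Facts347 g R₀ H₀ dF δ α L₀) (hrow : RowSum (toB6 g R₀ H₀) σ c)
    (h31 : Thm31GpMaj blkW blk Gp Dv Dvs R₀ H₀ B₀ δ₀) (h49 : Proj349Maj blkW blk P Dv Dvs R₀ H₀ CP δP)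
    (hD2 : HasMajorant (g := toB6 g R₀ H₀) blk D2 (fun (a b : g.Site) => θ₂ * (g.len a ^ 2)⁻¹ * Real.exp (-(δ₂ * g.dist a b))))
    (hR : R = ϱ • (LinearMap.id - P)) (hϱ : 0 ≤ ϱ) (hB₀ : 0 ≤ B₀) (hCP : 0 ≤ CP) (hθ₂ : 0 ≤ θ₂) (hc : 0 ≤ c) (hσ : 0 ≤ σ) (hτ : 0 ≤ α * δ)
    (hr₀ : r ≤ δ₀) (hrP : r ≤ δP) (hr₂ : r ≤ δ₂) (hδT₀ : 0 ≤ δT) (hδT : δT + 2 * σ + 3 * (α * δ) ≤ r) (w : ℝ) :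
    HasMaj (cNormR R₀ H₀ blkW hG.lenle (-1)) (cNormR R₀ H₀ blk hG.lenle 0) (w • (D2 ∘ₗ Dv ∘ₗ Gp ∘ₗ R))
      (fun a b => |w| * (θ₂ * g.L ^ 2 * (constA ϱ B₀ CP c g.L * g.L) * c) * Real.exp (-(δT * g.dist a b))) := by
  have hL0 : 0 ≤ g.L := le_trans zero_le_one hF.one_le_L
  have hA : 0 ≤ constA ϱ B₀ CP c g.L := constA_nonneg hϱ hB₀ hCP hc
  -- 𝒮† = DG′R : 𝔠_W^{(0)} → 𝔠^{(−1)}, shifted by −1: 𝔠_W^{(−1)} → 𝔠^{(−2)}, constant A·L, rate r − σ − 2αδ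
  have hSd := maj_DvGpR hG hF hrow (h31.dvGp_cls hG hB₀ hr₀) (h49.p_cls hG hCP hrP) hR hϱ hB₀ hCP hc hσ hτ (by linarith)
  have hSd' := hasMaj_shift hG hF (-1 : ℝ) (by norm_num) hA hSd
  rw [rpow_abs_eq_pow g.L (-1) 1 (by norm_num), pow_one, show (0 : ℝ) + -1 = -1 by norm_num, show (-1 : ℝ) + -1 = -2 by norm_num] at hSd'
  -- Δ⁽²⁾ : 𝔠^{(−2)} → 𝔠^{(0)}, rate r − αδ; composition at δ_T
  have hM := maj_M_R hG hF hθ₂ hr₂ (show (r - α * δ) + α * δ ≤ r by linarith) hD2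
  have hc1 := hasMaj_comp_cNormR hG hrow (mul_nonneg hθ₂ (pow_nonneg hL0 2)) (mul_nonneg hA hL0) hδT₀ (by linarith) (by linarith) hM hSd'
  refine (hasMaj_smul_exp hc1 w).congr (T' := w • (D2 ∘ₗ Dv ∘ₗ Gp ∘ₗ R)) fun μ => ?_
  simp only [LinearMap.smul_apply, LinearMap.comp_apply]

/-- ★ **THE Y-WORD `Δ⁽²⁾∘D_UG′R : 𝔠_W⁽¹⁾ → 𝔠⁽⁰⁾`** (integer state norms: it eats the right-neighbour output D\*_UG₀μ ∈ 𝔠_W⁽¹⁾ and returns a 𝔠⁽⁰⁾ input for the next G₀):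
majorant `|w|·(θ₂L²·A·L·c)·e^{−δ_T d}`. [cite: Balaban1985BackgroundPropagators, (3.135) p.422, (3.137) p.423, p.423, (3.42) p.397, (3.49) p.399; Balaban1984PropagatorsII, (2.54), (2.60)–(2.61) pp.233–234] -/
theorem maj_Y2 (hG : GeoOK g) (hF : Facts347 g R₀ H₀ dF δ α L₀) (hrow : RowSum (toB6 g R₀ H₀) σ c)
    (h31 : Thm31GpMaj blkW blk Gp Dv Dvs R₀ H₀ B₀ δ₀) (h49 : Proj349Maj blkW blk P Dv Dvs R₀ H₀ CP δP)
    (hD2 : HasMajorant (g := toB6 g R₀ H₀) blk D2 (fun (a b : g.Site) => θ₂ * (g.len a ^ 2)⁻¹ * Real.exp (-(δ₂ * g.dist a b))))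
    (hR : R = ϱ • (LinearMap.id - P)) (hϱ : 0 ≤ ϱ) (hB₀ : 0 ≤ B₀) (hCP : 0 ≤ CP) (hθ₂ : 0 ≤ θ₂) (hc : 0 ≤ c) (hσ : 0 ≤ σ) (hτ : 0 ≤ α * δ)
    (hr₀ : r ≤ δ₀) (hrP : r ≤ δP) (hr₂ : r ≤ δ₂) (hδT₀ : 0 ≤ δT) (hδT : δT + 2 * σ + 3 * (α * δ) ≤ r) (w : ℝ) :
    HasMaj (cNorm R₀ H₀ blkW hG.lenle 1) (cNorm R₀ H₀ blk hG.lenle 0) (w • (D2 ∘ₗ Dv ∘ₗ Gp ∘ₗ R))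
      (fun a b => |w| * (θ₂ * g.L ^ 2 * (constA ϱ B₀ CP c g.L * g.L) * c) * Real.exp (-(δT * g.dist a b))) := by
  have h := maj_Y2_R hG hF hrow h31 h49 hD2 hR hϱ hB₀ hCP hθ₂ hc hσ hτ hr₀ hrP hr₂ hδT₀ hδT w
  rw [show (-1 : ℝ) = -((1 : ℕ) : ℝ) by norm_num, show (0 : ℝ) = -((0 : ℕ) : ℝ) by norm_num] at h
  exact hasMaj_ofR hG h

/-- ★ **THE Z-WORD `RG′D\*_U∘Δ⁽²⁾∘D_UG′R : 𝔠_W⁽¹⁾ → 𝔠_W⁽¹⁾`** (between the leading D_U and the trailing D\*_U of (3.135)'s fourth term): 𝒮† shifted by −1, Δ⁽²⁾ shifted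
by −2, 𝒮 as it stands (`𝔠^{(0)} → 𝔠_W^{(−1)}`); majorant `|w|·(A·(θ₂L²·A·L·c)·c)·e^{−δ_T d}` for 0 ≦ δ_T, δ_T + 2σ + 3αδ ≦ r (two compositions, three transfers).
[cite: Balaban1985BackgroundPropagators, (3.135) p.422, (3.137) p.423, p.423, (3.42) p.397, (3.49) p.399; Balaban1984PropagatorsII, (2.54), (2.60)–(2.61) pp.233–234] -/
theorem maj_Z2 (hG : GeoOK g) (hF : Facts347 g R₀ H₀ dF δ α L₀) (hrow : RowSum (toB6 g R₀ H₀) σ c)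
    (h31 : Thm31GpMaj blkW blk Gp Dv Dvs R₀ H₀ B₀ δ₀) (h49 : Proj349Maj blkW blk P Dv Dvs R₀ H₀ CP δP)
    (hD2 : HasMajorant (g := toB6 g R₀ H₀) blk D2 (fun (a b : g.Site) => θ₂ * (g.len a ^ 2)⁻¹ * Real.exp (-(δ₂ * g.dist a b))))
    (hR : R = ϱ • (LinearMap.id - P)) (hϱ : 0 ≤ ϱ) (hB₀ : 0 ≤ B₀) (hCP : 0 ≤ CP) (hθ₂ : 0 ≤ θ₂) (hc : 0 ≤ c) (hσ : 0 ≤ σ) (hτ : 0 ≤ α * δ)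
    (hr₀ : r ≤ δ₀) (hrP : r ≤ δP) (hr₂ : r ≤ δ₂) (hδT₀ : 0 ≤ δT) (hδT : δT + 2 * σ + 3 * (α * δ) ≤ r) (w : ℝ) :
    HasMaj (cNorm R₀ H₀ blkW hG.lenle 1) (cNorm R₀ H₀ blkW hG.lenle 1) (w • (R ∘ₗ Gp ∘ₗ Dvs ∘ₗ D2 ∘ₗ Dv ∘ₗ Gp ∘ₗ R))
      (fun a b => |w| * (constA ϱ B₀ CP c g.L * (θ₂ * g.L ^ 2 * (constA ϱ B₀ CP c g.L * g.L) * c) * c) *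
        Real.exp (-(δT * g.dist a b))) := by
  have hL0 : 0 ≤ g.L := le_trans zero_le_one hF.one_le_L
  have hA : 0 ≤ constA ϱ B₀ CP c g.L := constA_nonneg hϱ hB₀ hCP hc
  have hK : 0 ≤ θ₂ * g.L ^ 2 * (constA ϱ B₀ CP c g.L * g.L) * c := mul_nonneg (mul_nonneg (mul_nonneg hθ₂ (pow_nonneg hL0 2)) (mul_nonneg hA hL0)) hc
  -- the Y-word (with the weight) at real weights, rate δ_T; then 𝒮 = RG′D* : 𝔠^{(0)} → 𝔠_W^{(−1)} (rate r − σ − αδ) after it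
  have hY := maj_Y2_R hG hF hrow h31 h49 hD2 hR hϱ hB₀ hCP hθ₂ hc hσ hτ hr₀ hrP hr₂ hδT₀ hδT w
  have hS := maj_RGpDvs hG hF hrow (h31.gpDvs_cls hG hB₀ hr₀) (h49.p_cls hG hCP hrP) hR hϱ hB₀ hCP hc hσ hτ (by linarith)
  have hc1 := hasMaj_comp_cNormR hG hrow hA (mul_nonneg (abs_nonneg w) hK) hδT₀ le_rfl (by linarith) hS hY
  rw [show (-1 : ℝ) = -((1 : ℕ) : ℝ) by norm_num] at hc1
  refine ((hasMaj_ofR hG hc1).congr (T' := w • (R ∘ₗ Gp ∘ₗ Dvs ∘ₗ D2 ∘ₗ Dv ∘ₗ Gp ∘ₗ R)) fun μ => ?_).mono fun a b => le_of_eq (by ring)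
  simp only [LinearMap.smul_apply, LinearMap.comp_apply, map_smul]

end Letters

/-! ## §3 The one-sided letters T_a₂ = Δ⁽²⁾π, T_b₂ = −𝒮T_a₂ from a REGULAR source class: print's (3.44) for the sandwich -/

section HolderSource

variable {blkW : XS → g.Site} {blk : XB → g.Site} {Gp P R : Module.End ℝ (XS → ℝ)} {Dv : (XS → ℝ) →ₗ[ℝ] (XB → ℝ)}
  {Dvs : (XB → ℝ) →ₗ[ℝ] (XS → ℝ)} {D2 : Module.End ℝ (XB → ℝ)} {B₀ δ₀ CP δP θ₂ δ₂ r δT ϱ σ c Cs C44 : ℝ} {dF : ℕ} {δ α L₀ : ℝ}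
  {F₂ : Type} [AddCommGroup F₂] [Module ℝ F₂]

omit [Fintype XS] in
/-- a majorant INTO `𝔠^{(−p)}` (real weight, p ∈ ℕ) out of ANY block norm is the same majorant INTO the integer-weight state norm `cNorm … p`.
[cite: Balaban1985BackgroundPropagators, (3.42) p.397 (bookkeeping)] -/
theorem hasMaj_tgt_ofR (hG : GeoOK g) {N : BlockNorm (toB6 g R₀ H₀) F₂} {T : F₂ →ₗ[ℝ] (XB → ℝ)} {K : g.Site → g.Site → ℝ} {p : ℕ}
    (h : HasMaj N (cNormR R₀ H₀ blk hG.lenle (-(p : ℝ))) T K) : HasMaj N (cNorm R₀ H₀ blk hG.lenle p) T K := by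
  intro y' μ hμ y
  rw [← cNormR_loc_neg_natCast hG]
  exact h y' μ hμ y

/-- ★★★ **T_a₂ = Δ⁽²⁾π FROM A REGULAR SOURCE — PRINT'S (3.44).**  The one-sided letter T_a₂ = Δ⁽²⁾∘(1 − D_UG′RD\*_U) (the left split `Letters3131.split₂`) is a printed
species as soon as its SOURCE is a class `b₁` on which (i) the sup channel reads at dimension 2 (`hsrc : id : b₁ → 𝔠^{(−2)}`) and (ii) the sandwich D_UG′D\*_U has
its (3.44) member at dimension 2 (`h44 : D_UG′D\*_U : b₁ → 𝔠^{(−2)}` — «|(∇_UG′(U)∇\*_Uλ)(x)| ≦ B₀′(ε)e^{−δ₀d}(‖λ‖^{ξ′}_ε + |λ|)», the N06 certificate's `h44G` species,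
read at the state's dimension): with R = ϱ(I − P), T_a₂ = Δ⁽²⁾ − ϱΔ⁽²⁾(D_UG′D\*_U) + ϱΔ⁽²⁾(D_UG′)(PD\*_U), the last word by (3.42)₂ + (3.49)₃ on the sup channel;
majorant `K·e^{−δ_T d}`, `K = θ₂L²·(C_s + |ϱ|C₄₄ + |ϱ|·B₀L·C_PL²·c·C_s·c)·c`, for 0 ≦ δ_T, δ_T + 3σ + 3αδ ≦ r ≦ min(δ₀, δ_P, δ₂) (all input rates weakened to r).
On the RAW class 𝔠⁽²⁾ hypothesis (ii) is not available (LOCATED-U8); on G₀-outputs it is Theorem 3.3's (3.42)₂ + (3.44).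
[cite: Balaban1985BackgroundPropagators, (3.135) p.422, (3.137) p.423, (3.44) p.398, (3.42) p.397, (3.49) p.399, p.421, p.423; Balaban1984PropagatorsII, (2.54), (2.60)–(2.61) pp.233–234] -/
theorem maj_ta2_of_src (hG : GeoOK g) (hF : Facts347 g R₀ H₀ dF δ α L₀) (hrow : RowSum (toB6 g R₀ H₀) σ c)
    {b₁ : BlockNorm (toB6 g R₀ H₀) (XB → ℝ)}
    (h31 : Thm31GpMaj blkW blk Gp Dv Dvs R₀ H₀ B₀ δ₀) (h49 : Proj349Maj blkW blk P Dv Dvs R₀ H₀ CP δP)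
    (hD2 : HasMajorant (g := toB6 g R₀ H₀) blk D2 (fun (a b : g.Site) => θ₂ * (g.len a ^ 2)⁻¹ * Real.exp (-(δ₂ * g.dist a b))))
    (hR : R = ϱ • (LinearMap.id - P))
    (hsrc : HasMaj b₁ (cNormR R₀ H₀ blk hG.lenle (-2)) LinearMap.id (fun a b => Cs * Real.exp (-(r * g.dist a b))))
    (h44 : HasMaj b₁ (cNormR R₀ H₀ blk hG.lenle (-2)) (Dv ∘ₗ Gp ∘ₗ Dvs) (fun a b => C44 * Real.exp (-(r * g.dist a b))))
    (hB₀ : 0 ≤ B₀) (hCP : 0 ≤ CP) (hθ₂ : 0 ≤ θ₂) (hCs : 0 ≤ Cs) (hC44 : 0 ≤ C44) (hc : 0 ≤ c) (hσ : 0 ≤ σ) (hτ : 0 ≤ α * δ)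
    (hr₀ : r ≤ δ₀) (hrP : r ≤ δP) (hr₂ : r ≤ δ₂) (hδT₀ : 0 ≤ δT) (hδT : δT + 3 * σ + 3 * (α * δ) ≤ r) :
    HasMaj b₁ (cNormR R₀ H₀ blk hG.lenle 0) (D2 ∘ₗ (LinearMap.id - Dv ∘ₗ Gp ∘ₗ R ∘ₗ Dvs))
      (fun a b => θ₂ * g.L ^ 2 * (Cs + |ϱ| * C44 + |ϱ| * (B₀ * g.L * (CP * g.L ^ 2) * c * Cs * c)) * c * Real.exp (-(δT * g.dist a b))) := by
  have hL0 : 0 ≤ g.L := le_trans zero_le_one hF.one_le_L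
  have hM2 : 0 ≤ θ₂ * g.L ^ 2 := mul_nonneg hθ₂ (pow_nonneg hL0 2)
  -- Δ⁽²⁾ : 𝔠^{(−2)} → 𝔠^{(0)}, rate r − αδ
  have hM := maj_M_R hG hF hθ₂ hr₂ (show (r - α * δ) + α * δ ≤ r by linarith) hD2
  -- term 1: Δ⁽²⁾ after the sup channel of the source
  have t1 := hasMaj_comp_cNormR hG hrow hM2 hCs hδT₀ (by linarith) (by linarith) hM hsrc
  -- term 2: Δ⁽²⁾ after the (3.44) member of the source
  have t2 := hasMaj_comp_cNormR hG hrow hM2 hC44 hδT₀ (by linarith) (by linarith) hM h44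
  -- term 3: Δ⁽²⁾ ∘ (D_UG′) ∘ (PD*_U) ∘ (sup channel): (3.49)₃ shifted by −2, (3.42)₂ shifted by −1
  have hPd := hasMaj_shift hG hF (-2 : ℝ) (by norm_num) hCP (h49.pDvs_cls hG hCP hrP)
  rw [rpow_abs_eq_pow g.L (-2) 2 (by norm_num), show (0 : ℝ) + -2 = -2 by norm_num, show (1 : ℝ) + -2 = -1 by norm_num] at hPd
  have hDg := hasMaj_shift hG hF (-1 : ℝ) (by norm_num) hB₀ (h31.dvGp_cls hG hB₀ hr₀)
  rw [rpow_abs_eq_pow g.L (-1) 1 (by norm_num), pow_one, show (0 : ℝ) + -1 = -1 by norm_num, show (-1 : ℝ) + -1 = -2 by norm_num] at hDg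
  have c32 := hasMaj_comp_cNormR hG hrow (mul_nonneg hB₀ hL0) (mul_nonneg hCP (pow_nonneg hL0 2)) (show 0 ≤ r - σ - α * δ by linarith)
    (by linarith) (by linarith) hDg hPd
  have c321 := hasMaj_comp_cNormR hG hrow (mul_nonneg (mul_nonneg (mul_nonneg hB₀ hL0) (mul_nonneg hCP (pow_nonneg hL0 2))) hc) hCs
    (show 0 ≤ r - 2 * σ - α * δ by linarith) (by linarith) (by linarith) c32 hsrc
  have t3 := hasMaj_comp_cNormR hG hrow hM2 (mul_nonneg (mul_nonneg (mul_nonneg (mul_nonneg (mul_nonneg hB₀ hL0) (mul_nonneg hCP (pow_nonneg hL0 2))) hc) hCs) hc)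
    hδT₀ (by linarith) (by linarith) hM c321
  -- assemble T_a₂ = t1 − ϱ•t2 + ϱ•t3
  have hsum := (t1.sub (hasMaj_smul_cNormR t2 ϱ)).add (hasMaj_smul_cNormR t3 ϱ)
  refine (hsum.congr (T' := D2 ∘ₗ (LinearMap.id - Dv ∘ₗ Gp ∘ₗ R ∘ₗ Dvs)) fun μ => ?_).mono fun a b => le_of_eq ?_
  · simp only [hR, LinearMap.add_apply, LinearMap.sub_apply, LinearMap.smul_apply, LinearMap.comp_apply, LinearMap.id_apply, map_smul, map_sub,
      smul_sub]
    abel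
  · ring

/-- ★★ **T_b₂ = −RG′D\*_U∘T_a₂ FROM A REGULAR SOURCE, SUP TARGET `𝔠_W^{(−1)}`** (𝒮 = RG′D\*_U by (3.42)₃ + (3.49)₁ after the letter above): majorant `A·K·c·e^{−δ_T d}`.
The Hölder-target twin (INTO the transported class from ONE (3.43) member) is the pin reading of the sequel. [cite: Balaban1985BackgroundPropagators, (3.135) p.422, (3.137) p.423, (3.44) p.398, (3.42) p.397, (3.49) p.399, p.421; Balaban1984PropagatorsII, (2.54), (2.60)–(2.61) pp.233–234] -/
theorem maj_tb2_of_src (hG : GeoOK g) (hF : Facts347 g R₀ H₀ dF δ α L₀) (hrow : RowSum (toB6 g R₀ H₀) σ c)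
    {b₁ : BlockNorm (toB6 g R₀ H₀) (XB → ℝ)}
    (h31 : Thm31GpMaj blkW blk Gp Dv Dvs R₀ H₀ B₀ δ₀) (h49 : Proj349Maj blkW blk P Dv Dvs R₀ H₀ CP δP)
    (hD2 : HasMajorant (g := toB6 g R₀ H₀) blk D2 (fun (a b : g.Site) => θ₂ * (g.len a ^ 2)⁻¹ * Real.exp (-(δ₂ * g.dist a b))))
    (hR : R = ϱ • (LinearMap.id - P))
    (hsrc : HasMaj b₁ (cNormR R₀ H₀ blk hG.lenle (-2)) LinearMap.id (fun a b => Cs * Real.exp (-(r * g.dist a b))))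
    (h44 : HasMaj b₁ (cNormR R₀ H₀ blk hG.lenle (-2)) (Dv ∘ₗ Gp ∘ₗ Dvs) (fun a b => C44 * Real.exp (-(r * g.dist a b))))
    (hϱ : 0 ≤ ϱ) (hB₀ : 0 ≤ B₀) (hCP : 0 ≤ CP) (hθ₂ : 0 ≤ θ₂) (hCs : 0 ≤ Cs) (hC44 : 0 ≤ C44) (hc : 0 ≤ c) (hσ : 0 ≤ σ) (hτ : 0 ≤ α * δ)
    (hr₀ : r ≤ δ₀) (hrP : r ≤ δP) (hr₂ : r ≤ δ₂) (hδT₀ : 0 ≤ δT) (hδT : δT + 3 * σ + 3 * (α * δ) ≤ r) :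
    HasMaj b₁ (cNormR R₀ H₀ blkW hG.lenle (-1)) (-(R ∘ₗ Gp ∘ₗ Dvs ∘ₗ (D2 ∘ₗ (LinearMap.id - Dv ∘ₗ Gp ∘ₗ R ∘ₗ Dvs))))
      (fun a b => constA ϱ B₀ CP c g.L * (θ₂ * g.L ^ 2 * (Cs + |ϱ| * C44 + |ϱ| * (B₀ * g.L * (CP * g.L ^ 2) * c * Cs * c)) * c) * c *
        Real.exp (-(δT * g.dist a b))) := by
  have hL0 : 0 ≤ g.L := le_trans zero_le_one hF.one_le_L
  have hA : 0 ≤ constA ϱ B₀ CP c g.L := constA_nonneg hϱ hB₀ hCP hc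
  have hK : 0 ≤ θ₂ * g.L ^ 2 * (Cs + |ϱ| * C44 + |ϱ| * (B₀ * g.L * (CP * g.L ^ 2) * c * Cs * c)) * c := by positivity
  have hT := maj_ta2_of_src hG hF hrow h31 h49 hD2 hR hsrc h44 hB₀ hCP hθ₂ hCs hC44 hc hσ hτ hr₀ hrP hr₂ hδT₀ hδT
  have hS := maj_RGpDvs hG hF hrow (h31.gpDvs_cls hG hB₀ hr₀) (h49.p_cls hG hCP hrP) hR hϱ hB₀ hCP hc hσ hτ (by linarith)
  have hc1 := hasMaj_comp_cNormR hG hrow hA hK hδT₀ le_rfl (by linarith) hS hT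
  exact hc1.neg.congr fun μ => rfl

end HolderSource

end

end Literature.MathematicalPhysics.QuantumFieldTheory.Balaban1983to89.B9PerturbationMajorant2Letters
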